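import Summits.CriticalPhenomena.PercolationContinuityZ3.Theorems.Transplant.FKDoubleFanCrossApexCore
import HarnessLib

/-!
# Double fans, cross-apex adjacent pair: ROOF POINTS — the normalized identities of a `U`-tight vector and the roof × roof inequality
# in fibre coordinates

Helper file (`--supports stmt-CriticalPhenomena-4575`), FK sub-lane `prim-bschramm-fk-3` (gen 25); builds on p205010 (kernel theorem, internal
audit signed; external expert review pending).  Pure real algebra, no sorries; standard axioms.  Memo `bschramm/prim-bschramm-fk-3/U-RIM.md` §4d.

Step two of the cross-apex programme (`…DoubleFanCrossApexCore` is step one).  In the apex-`b` split a fibre-mass vector is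
`vecB q W y X Z u₀ = (u₀, X, y − u₀, Z, W − qy − X − Z)` (`X = Z_ab`, `Z = Z_bc`, `y = Z_0 + Z_ac`, `W = W_b = |Z| − (1−q)y`), and the apex-`a`
split of the other side is `swapAB (vecB q W' z X' Y' s₀)`.  For fixed `(W, y)` the cross form `crossL` (`= (Z¹⁰Z⁰¹−Z¹¹Z⁰⁰)/(q²(1−q))`,
`crossL_eq`) is LINEAR in `(X, Z, u₀)` (`crossL_linB`) and affine along the `u₀`-direction (`crossL_u0_affine`) — the tool for the convex
decomposition of the sequel.  A ROOF POINT with tight probe `w ∈ [0,1]` is a `vecB` satisfying the direction relation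
`q(X−Z)w² + 2((1−q)X + Z)w − (2−q)Z = 0` and the tightness relation `I_b·N(w) = W·D(w)` (`I_b = u₀(W−qy) − (X+Z)y`, `N = (1−q) + qw(1−w)`,
`D = w²X + (1−w)²Z`).  With `M := (X+Z+qu₀)(W−qy) = M_b`: `N^{(bc)} = Mw²`, `N^{(ab)} = M(1−w)²`, `(2−q)I_b = M·2w(1−w)`, `(2−q)ZW = M·zw`,
`(2−q)XW = M·xw` (`roofB_*`, each a two-term `linear_combination` of the relations).  Cancelling `N(w) > 0` and feeding these into
`cross_roof_core` gives **`crossL_roof_roof_nonneg`**: the cross form is `≥ 0` for every pair of roof points (`(2−q)²·L = M M'·(core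
bracket)` is ONE `linear_combination` of the normalized identities, the `u₀v`-values enter through `roofB_U`:
`(2−q)u₀v(1−qt) = M·cxUV(√q,w,t)`).  The sequel (`…DoubleFanCrossApexInKE`) decomposes `InKE × InKE` into floor and roof rays.
[folklore]
-/

noncomputable section

namespace Summit.CriticalPhenomena.PercolationContinuityZ3.Theorems

namespace FK

namespace ThreeApex

/-! ### Coordinates and the cross form -/

/-- The apex-`b` split: `vecB q W y X Z u₀ = (u₀, X, y − u₀, Z, W − qy − X − Z)`. [folklore] -/
def vecB (q W y X Z u0 : ℝ) : V5 := ⟨u0, X, y - u0, Z, W - q * y - X - Z⟩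

/-- Every vector is a `vecB` of its apex-`b` data. [folklore] -/
theorem vecB_eta (q : ℝ) (u : V5) : vecB q (u.total - (1 - q) * (u.z0 + u.zac)) (u.z0 + u.zac) u.zab u.zbc u.z0 = u := by
  ext <;> simp only [vecB, V5.total] <;> ring

/-- The cross form `L(r;u,s) = (1−r)N^{(bc)}(u)N^{(ac)}(s) + r(r+(1−r)q)N^{(ab)}(u∗s) − (1−q)(2−q)r(1−r)C(u,s)`. [folklore] -/
def crossL (q r : ℝ) (u s : V5) : ℝ :=
  (1 - r) * (masterN q (swapAB u) * masterN q s) + r * (r + (1 - r) * q) * masterN q (swapBC (conv u s))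
    - (1 - q) * (2 - q) * (r * (1 - r)) * crossC u s

/-- `Z¹⁰Z⁰¹ − Z¹¹Z⁰⁰ = q²(1−q)·L`. [folklore] -/
theorem crossL_eq (q r : ℝ) (u s : V5) :
    crossZ q r u s 1 0 * crossZ q r u s 0 1 - crossZ q r u s 1 1 * crossZ q r u s 0 0 = q ^ 2 * (1 - q) * crossL q r u s := by
  rw [rayleigh_cross_eq]; rfl

/-- **Linearity in the apex-`b` coordinates**: for fixed `(W, y)` and `s`, `L` is linear in `(X, Z, u₀)`. [folklore] -/
theorem crossL_linB (q r W y X Z u0 : ℝ) (s : V5) :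
    crossL q r (vecB q W y X Z u0) s = X * crossL q r (vecB q W y 1 0 0) s + Z * crossL q r (vecB q W y 0 1 0) s
      + u0 * crossL q r (vecB q W y 0 0 1) s := by
  simp only [crossL, crossC, vecB, masterN, swapAB, swapBC, conv, kap, jA, hx, hy, hz, V5.total]; ring

/-- `L` is affine along the `u₀`-direction: convex combinations pass through. [folklore] -/
theorem crossL_u0_affine (q r W y X Z a b c : ℝ) (s : V5) :
    crossL q r (vecB q W y X Z (c * a + (1 - c) * b)) s =
      c * crossL q r (vecB q W y X Z a) s + (1 - c) * crossL q r (vecB q W y X Z b) s := by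
  rw [crossL_linB q r W y X Z (c * a + (1 - c) * b), crossL_linB q r W y X Z a, crossL_linB q r W y X Z b]; ring

/-- Symmetric linearity in the apex-`a` coordinates of the second argument (`s = swapAB (vecB q W' z X' Y' s₀)`). [folklore] -/
theorem crossL_linA (q r W z X Y s0 : ℝ) (u : V5) :
    crossL q r u (swapAB (vecB q W z X Y s0)) = X * crossL q r u (swapAB (vecB q W z 1 0 0)) + Y * crossL q r u (swapAB (vecB q W z 0 1 0))
      + s0 * crossL q r u (swapAB (vecB q W z 0 0 1)) := by
  simp only [crossL, crossC, vecB, masterN, swapAB, swapBC, conv, kap, jA, hx, hy, hz, V5.total]; ring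

/-- Affinity along `s₀`. [folklore] -/
theorem crossL_s0_affine (q r W z X Y a b c : ℝ) (u : V5) :
    crossL q r u (swapAB (vecB q W z X Y (c * a + (1 - c) * b))) =
      c * crossL q r u (swapAB (vecB q W z X Y a)) + (1 - c) * crossL q r u (swapAB (vecB q W z X Y b)) := by
  rw [crossL_linA q r W z X Y (c * a + (1 - c) * b), crossL_linA q r W z X Y a, crossL_linA q r W z X Y b]; ring

/-! ### Roof points: the normalized identities -/

section roof

variable {q W y X Z u0 w : ℝ}
  (hR : q * (X - Z) * w ^ 2 + 2 * ((1 - q) * X + Z) * w - (2 - q) * Z = 0)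
  (hT : (u0 * (W - q * y) - (X + Z) * y) * ((1 - q) + q * w * (1 - w)) = W * (w ^ 2 * X + (1 - w) ^ 2 * Z))
include hR hT

/-- `N^{(bc)}·N = M w²·N`. [folklore] -/
theorem roofB_nbc : masterN q (swapAB (vecB q W y X Z u0)) * ((1 - q) + q * w * (1 - w)) =
    (X + Z + q * u0) * (W - q * y) * w ^ 2 * ((1 - q) + q * w * (1 - w)) := by
  simp only [masterN, swapAB, vecB]
  linear_combination (q - 1 - q * w ^ 2) * hT + (-(W * w)) * hR

/-- `N^{(ab)}·N = M (1−w)²·N`. [folklore] -/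
theorem roofB_nab : masterN q (swapBC (vecB q W y X Z u0)) * ((1 - q) + q * w * (1 - w)) =
    (X + Z + q * u0) * (W - q * y) * (1 - w) ^ 2 * ((1 - q) + q * w * (1 - w)) := by
  simp only [masterN, swapBC, vecB]
  linear_combination (-1 + 2 * q * w - q * w ^ 2) * hT + (W * (1 - w)) * hR

/-- `(2−q)·I_b·N = M·2w(1−w)·N`. [folklore] -/
theorem roofB_I : (2 - q) * (u0 * (W - q * y) - (X + Z) * y) * ((1 - q) + q * w * (1 - w)) =
    (X + Z + q * u0) * (W - q * y) * ((1 - q) + q * w * (1 - w)) * (2 * w * (1 - w)) := by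
  linear_combination (2 - q - 2 * q * w + 2 * q * w ^ 2) * hT + (W * (2 * w - 1)) * hR

/-- `(2−q)·Z·W·N = M·N·zw`, `zw = (2−q)w² + (1−q)2w(1−w)`. [folklore] -/
theorem roofB_zw : (2 - q) * Z * W * ((1 - q) + q * w * (1 - w)) =
    (X + Z + q * u0) * (W - q * y) * ((1 - q) + q * w * (1 - w)) * ((2 - q) * w ^ 2 + (1 - q) * (2 * w * (1 - w))) := by
  linear_combination (-(q ^ 2 * w ^ 2) + 2 * q ^ 2 * w - 2 * q * w) * hT + (W * (q - 1 - q * w)) * hR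

/-- `(2−q)·X·W·N = M·N·xw`, `xw = (2−q)(1−w)² + (1−q)2w(1−w)`. [folklore] -/
theorem roofB_xw : (2 - q) * X * W * ((1 - q) + q * w * (1 - w)) =
    (X + Z + q * u0) * (W - q * y) * ((1 - q) + q * w * (1 - w)) * ((2 - q) * (1 - w) ^ 2 + (1 - q) * (2 * w * (1 - w))) := by
  linear_combination (-(q ^ 2 * w ^ 2) + 2 * q * w + q ^ 2 - 2 * q) * hT + (W * (1 - q * w)) * hR

end roof

/-! ### The roof × roof inequality in fibre coordinates -/

/-- The `u₀v`-value of a roof point dominates the lossy bound: from the normalized identities `(2−q)I_b = M·E(w)` and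
`(2−q)(X+Z)W = M·(xw+zw)` one gets `(2−q)·u₀(W+(1−q)tW)·(1−qt) = M·cxUV(√q,w,t)`, hence a `U` with `(2−q)u₀v = M·U` and
`cxUV ≤ U` (also when `M = 0`). [folklore] -/
theorem roofB_U {q W t X Z u0 w M s : ℝ} (hq2 : q < 2) (hs2 : s ^ 2 = q) (hW : q * (t * W) < W) (hWp : 0 < W)
    (ht : 0 ≤ t) (hu0 : 0 ≤ u0) (hq0 : 0 ≤ q) (hMn : 0 ≤ M)
    (e3 : (2 - q) * (u0 * (W - q * (t * W)) - (X + Z) * (t * W)) = M * (2 * w * (1 - w)))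
    (e45 : (2 - q) * Z * W + (2 - q) * X * W =
      M * ((2 - q) * w ^ 2 + (1 - q) * (2 * w * (1 - w))) + M * ((2 - q) * (1 - w) ^ 2 + (1 - q) * (2 * w * (1 - w)))) :
    ∃ U, (2 - q) * (u0 * (W + (1 - q) * (t * W))) = M * U ∧ cxUV s w t ≤ U := by
  have hqt : q * t < 1 := by nlinarith
  have hP : (2 - q) * (u0 * (W + (1 - q) * (t * W))) * (1 - q * t) = M * cxUV s w t := by
    simp only [cxUV, cxE, hs2]
    linear_combination (1 + (1 - q) * t) * e3 + ((1 + (1 - q) * t) * t) * e45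
  rcases eq_or_lt_of_le hMn with hM0 | hMp
  · refine ⟨cxUV s w t, ?_, le_rfl⟩
    rw [← hM0, zero_mul] at hP ⊢
    rcases mul_eq_zero.1 hP with h | h
    · exact h
    · exact absurd h (sub_pos.2 hqt).ne'
  · have hMne : M ≠ 0 := hMp.ne'
    refine ⟨(2 - q) * (u0 * (W + (1 - q) * (t * W))) / M, ?_, ?_⟩
    · rw [mul_div_assoc']; exact (mul_div_cancel_left₀ _ hMne).symm
    · rw [le_div_iff₀ hMp]
      have hv : 0 ≤ W + (1 - q) * (t * W) := by nlinarith
      have : 0 ≤ (2 - q) * (u0 * (W + (1 - q) * (t * W))) * (q * t) :=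
        mul_nonneg (mul_nonneg (by linarith) (mul_nonneg hu0 hv)) (mul_nonneg hq0 ht)
      nlinarith [hP, this]

/-- **Two roof points give a non-negative cross form.**  For `0 < q ≤ 1`, `r ∈ [0,1]` and, on each side, apex data with `q·y < W`,
masses `≥ 0`, a probe `w ∈ [0,1]` with `N(w) = (1−q) + qw(1−w) > 0` satisfying the direction relation and the tightness relation
(`roofB_*`), `crossL ≥ 0`.  Proof: `(2−q)²·crossL = M M'·(core bracket)` (a `linear_combination` of the normalized identities) and
`cross_roof_core`. [folklore] -/
theorem crossL_roof_roof_nonneg {q r : ℝ} (hq0 : 0 < q) (hq1 : q ≤ 1) (hr0 : 0 ≤ r) (hr1 : r ≤ 1)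
    {W y X Z u0 w : ℝ} (hW : q * y < W) (hy0 : 0 ≤ y) (hX : 0 ≤ X) (hZ : 0 ≤ Z) (hu0 : 0 ≤ u0)
    (hw0 : 0 ≤ w) (hw1 : w ≤ 1) (hN : 0 < (1 - q) + q * w * (1 - w))
    (hR : q * (X - Z) * w ^ 2 + 2 * ((1 - q) * X + Z) * w - (2 - q) * Z = 0)
    (hT : (u0 * (W - q * y) - (X + Z) * y) * ((1 - q) + q * w * (1 - w)) = W * (w ^ 2 * X + (1 - w) ^ 2 * Z))
    {W' z X' Y' s0 w' : ℝ} (hW' : q * z < W') (hz0 : 0 ≤ z) (hX' : 0 ≤ X') (hY' : 0 ≤ Y') (hs0 : 0 ≤ s0)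
    (hw0' : 0 ≤ w') (hw1' : w' ≤ 1) (hN' : 0 < (1 - q) + q * w' * (1 - w'))
    (hR' : q * (X' - Y') * w' ^ 2 + 2 * ((1 - q) * X' + Y') * w' - (2 - q) * Y' = 0)
    (hT' : (s0 * (W' - q * z) - (X' + Y') * z) * ((1 - q) + q * w' * (1 - w')) = W' * (w' ^ 2 * X' + (1 - w') ^ 2 * Y')) :
    0 ≤ crossL q r (vecB q W y X Z u0) (swapAB (vecB q W' z X' Y' s0)) := by
  have h2q : 0 < 2 - q := by linarith
  have hq2 : q < 2 := by linarith
  have hWp : 0 < W := lt_of_le_of_lt (by positivity) hW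
  have hWp' : 0 < W' := lt_of_le_of_lt (by positivity) hW'
  obtain ⟨t, ht0, rfl⟩ : ∃ t, 0 ≤ t ∧ y = t * W := ⟨y / W, div_nonneg hy0 hWp.le, by field_simp⟩
  obtain ⟨t', ht0', rfl⟩ : ∃ t', 0 ≤ t' ∧ z = t' * W' := ⟨z / W', div_nonneg hz0 hWp'.le, by field_simp⟩
  have hWq : 0 < W - q * (t * W) := by linarith
  have hWq' : 0 < W' - q * (t' * W') := by linarith
  obtain ⟨s, hs0s, hs2⟩ : ∃ s : ℝ, 0 ≤ s ∧ s ^ 2 = q := ⟨Real.sqrt q, Real.sqrt_nonneg q, Real.sq_sqrt hq0.le⟩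
  have hs1 : s ≤ 1 := by nlinarith
  obtain ⟨M, hM⟩ : ∃ M : ℝ, M = (X + Z + q * u0) * (W - q * (t * W)) := ⟨_, rfl⟩
  obtain ⟨M', hM'⟩ : ∃ M' : ℝ, M' = (X' + Y' + q * s0) * (W' - q * (t' * W')) := ⟨_, rfl⟩
  have hMn : 0 ≤ M := by rw [hM]; exact mul_nonneg (by positivity) hWq.le
  have hMn' : 0 ≤ M' := by rw [hM']; exact mul_nonneg (by positivity) hWq'.le
  -- the normalized identities (cancel `N > 0`)
  have e1 : masterN q (swapAB (vecB q W (t * W) X Z u0)) = M * w ^ 2 := by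
    apply mul_right_cancel₀ hN.ne'; rw [roofB_nbc hR hT, hM]
  have e2 : masterN q (swapBC (vecB q W (t * W) X Z u0)) = M * (1 - w) ^ 2 := by
    apply mul_right_cancel₀ hN.ne'; rw [roofB_nab hR hT, hM]
  have e3 : (2 - q) * (u0 * (W - q * (t * W)) - (X + Z) * (t * W)) = M * (2 * w * (1 - w)) := by
    apply mul_right_cancel₀ hN.ne'; rw [roofB_I hR hT, hM]; ring
  have e4 : (2 - q) * Z * W = M * ((2 - q) * w ^ 2 + (1 - q) * (2 * w * (1 - w))) := by
    apply mul_right_cancel₀ hN.ne'; rw [roofB_zw hR hT, hM]; ring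
  have e5 : (2 - q) * X * W = M * ((2 - q) * (1 - w) ^ 2 + (1 - q) * (2 * w * (1 - w))) := by
    apply mul_right_cancel₀ hN.ne'; rw [roofB_xw hR hT, hM]; ring
  have f1 : masterN q (swapAB (vecB q W' (t' * W') X' Y' s0)) = M' * w' ^ 2 := by
    apply mul_right_cancel₀ hN'.ne'; rw [roofB_nbc hR' hT', hM']
  have f2 : masterN q (swapBC (vecB q W' (t' * W') X' Y' s0)) = M' * (1 - w') ^ 2 := by
    apply mul_right_cancel₀ hN'.ne'; rw [roofB_nab hR' hT', hM']
  have f3 : (2 - q) * (s0 * (W' - q * (t' * W')) - (X' + Y') * (t' * W')) = M' * (2 * w' * (1 - w')) := by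
    apply mul_right_cancel₀ hN'.ne'; rw [roofB_I hR' hT', hM']; ring
  have f4 : (2 - q) * Y' * W' = M' * ((2 - q) * w' ^ 2 + (1 - q) * (2 * w' * (1 - w'))) := by
    apply mul_right_cancel₀ hN'.ne'; rw [roofB_zw hR' hT', hM']; ring
  have f5 : (2 - q) * X' * W' = M' * ((2 - q) * (1 - w') ^ 2 + (1 - q) * (2 * w' * (1 - w'))) := by
    apply mul_right_cancel₀ hN'.ne'; rw [roofB_xw hR' hT', hM']; ring
  -- the cross form in coordinates
  have eL : crossL q r (vecB q W (t * W) X Z u0) (swapAB (vecB q W' (t' * W') X' Y' s0)) =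
      (1 - r) * (masterN q (swapAB (vecB q W (t * W) X Z u0)) * masterN q (swapAB (vecB q W' (t' * W') X' Y' s0)))
      + r * (r + (1 - r) * q) * (u0 * (W + (1 - q) * (t * W)) * masterN q (swapBC (vecB q W' (t' * W') X' Y' s0))
          + s0 * (W' + (1 - q) * (t' * W')) * masterN q (swapBC (vecB q W (t * W) X Z u0))
          + X * X' * ((W + (1 - q) * (t * W)) * (W' + (1 - q) * (t' * W')))
          + (1 - q) * ((u0 * (W - q * (t * W)) - (X + Z) * (t * W)) + X * (t * W))
              * ((s0 * (W' - q * (t' * W')) - (X' + Y') * (t' * W')) + X' * (t' * W')))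
      - (1 - q) * (2 - q) * (r * (1 - r)) *
          (((u0 * (W - q * (t * W)) - (X + Z) * (t * W)) + Z * (t * W)) * (s0 * (W' - q * (t' * W')) - (X' + Y') * (t' * W'))
            + (u0 * (W - q * (t * W)) - (X + Z) * (t * W)) * (Y' * (t' * W'))) := by
    simp only [crossL, crossC, vecB, masterN, swapAB, swapBC, conv, kap, jA, hx, hy, hz, V5.total]; ring
  -- the two `U`-values and the core inequality
  obtain ⟨U, hUdef, hUle⟩ := roofB_U hq2 hs2 hW hWp ht0 hu0 hq0.le hMn e3 (by linear_combination e4 + e5)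
  obtain ⟨U', hUdef', hUle'⟩ := roofB_U hq2 hs2 hW' hWp' ht0' hs0 hq0.le hMn' f3 (by linear_combination f4 + f5)
  have key := cross_roof_core hs0s hs1 hw0 hw1 hw0' hw1' ht0 ht0' hr0 hr1 hUle hUle'
  have hid : (2 - q) ^ 2 * crossL q r (vecB q W (t * W) X Z u0) (swapAB (vecB q W' (t' * W') X' Y' s0)) =
      M * M' * ((1 - r) * (2 - s ^ 2) ^ 2 * (w ^ 2 * w' ^ 2) + r * (r + (1 - r) * s ^ 2) * cxA2S s w w' t t' U U'
        - (1 - s ^ 2) * (2 - s ^ 2) * (r * (1 - r)) * cxCS s w w' t t') := by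
    rw [eL, e1, e2, f1, f2]
    simp only [cxA2S, cxCS, cxXW, cxZW, cxE, hs2]
    linear_combination
      (r * (r + (1 - r) * q) * (2 - q) * M' * (1 - w') ^ 2) * hUdef
      + (r * (r + (1 - r) * q) * (2 - q) * M * (1 - w) ^ 2) * hUdef'
      + (r * (r + (1 - r) * q) * (1 + (1 - q) * t) * (1 + (1 - q) * t') * ((2 - q) * X' * W')
          + r * (r + (1 - r) * q) * (1 - q)
            * ((2 - q) * ((s0 * (W' - q * (t' * W')) - (X' + Y') * (t' * W')) + X' * (t' * W'))) * t) * e5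
      + (r * (r + (1 - r) * q) * (1 + (1 - q) * t) * (1 + (1 - q) * t') * (M * ((2 - q) * (1 - w) ^ 2 + (1 - q) * (2 * w * (1 - w))))
          + r * (r + (1 - r) * q) * (1 - q)
            * (M * ((2 * w * (1 - w)) + ((2 - q) * (1 - w) ^ 2 + (1 - q) * (2 * w * (1 - w))) * t)) * t') * f5
      + (r * (r + (1 - r) * q) * (1 - q) * ((2 - q) * ((s0 * (W' - q * (t' * W')) - (X' + Y') * (t' * W')) + X' * (t' * W')))
          - (1 - q) * (2 - q) * (r * (1 - r)) * ((2 - q) * (s0 * (W' - q * (t' * W')) - (X' + Y') * (t' * W')))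
          - (1 - q) * (2 - q) * (r * (1 - r)) * ((2 - q) * Y' * (t' * W'))) * e3
      - ((1 - q) * (2 - q) * (r * (1 - r)) * ((2 - q) * (s0 * (W' - q * (t' * W')) - (X' + Y') * (t' * W'))) * t) * e4
      + (r * (r + (1 - r) * q) * (1 - q) * (M * ((2 * w * (1 - w)) + ((2 - q) * (1 - w) ^ 2 + (1 - q) * (2 * w * (1 - w))) * t))
          - (1 - q) * (2 - q) * (r * (1 - r)) * (M * ((2 * w * (1 - w)) + ((2 - q) * w ^ 2 + (1 - q) * (2 * w * (1 - w))) * t))) * f3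
      - ((1 - q) * (2 - q) * (r * (1 - r)) * (M * (2 * w * (1 - w))) * t') * f4
  rw [← mul_nonneg_iff_of_pos_left (pow_pos h2q 2), hid]
  exact mul_nonneg (mul_nonneg hMn hMn') (by linarith [key])

end ThreeApex

end FK

end Summit.CriticalPhenomena.PercolationContinuityZ3.Theorems
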